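import Summits.MatrixMultiplication.MatrixMultiplication.Theorems.SoloInformedFibrePlanes
import Mathlib.Algebra.Order.Chebyshev

/-!
# Pair counting: few fibres force many same-fibre pairs

This work, §8.7 (m) / referee note `paircount-m2.md` §1. For any map `F : T → α` on a finite type (the flat
chart `F⁰` on the `n³` index triples), with `N₀ = |im F|` fibres and `P = #{(τ,τ') : F τ = F τ'}` ordered pairs
in a common fibre (`P = n³ + Z` in the notation of §8.7 (m), `Z` = pairs of DISTINCT triples), Cauchy–Schwarz
gives `|T|² ≤ N₀ · P`, i.e. `N₀ ≥ n⁶ / (n³ + Z)`. Together with LEMMA Z (`SoloInformedFibreLines`,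
`SoloInformedFibrePlanes`: same-fibre pairs with an index coincidence number at most `3(r-1)n³`) this reduces
Conjecture C3 for one involutory multiplier to a bound `Z₀ = O(r n³)` on GENERIC same-fibre pairs.
References: this work §8.7 (l)–(m); CohnUmans2013 (arXiv:1207.6528) Def. 12.
-/

namespace Summit.MatrixMultiplication.MatrixMultiplication.Theorems.TwistedTPP.FibreLines

open Finset

/-- The ordered pairs with equal `F`-value are counted by the sum of the squared fibre sizes.
[this work, §8.7 (m)] -/
theorem card_pairs_eq_sum_sq {T α : Type*} [Fintype T] [DecidableEq T] [DecidableEq α] (F : T → α) :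
    ((univ : Finset (T × T)).filter (fun p => F p.1 = F p.2)).card
      = ∑ s ∈ univ.image F, ((univ : Finset T).filter (fun τ => F τ = s)).card ^ 2 := by
  rw [card_eq_sum_card_fiberwise (f := fun p : T × T => F p.1) (t := univ.image F)
        (fun p _ => mem_image_of_mem F (mem_univ p.1))]
  refine sum_congr rfl fun s _ => ?_
  have h : ((univ : Finset (T × T)).filter (fun p => F p.1 = F p.2)).filter (fun p => F p.1 = s)
      = ((univ : Finset T).filter (fun τ => F τ = s)) ×ˢ ((univ : Finset T).filter (fun τ => F τ = s)) := by
    ext p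
    simp only [mem_filter, mem_univ, true_and, mem_product]
    constructor
    · rintro ⟨h12, h1⟩
      exact ⟨h1, h12 ▸ h1⟩
    · rintro ⟨h1, h2⟩
      exact ⟨h1.trans h2.symm, h1⟩
  rw [h, card_product, sq]

/-- **Pair-counting inequality** `|T|² ≤ N₀ · #{(τ,τ') : F τ = F τ'}`: a chart with few fibres has many
ordered same-fibre pairs (Cauchy–Schwarz). With `|T| = n³` and `#pairs = n³ + Z`: `N₀ ≥ n⁶/(n³ + Z)`.
[this work, §8.7 (m)] -/
theorem card_sq_le_card_image_mul_card_pairs {T α : Type*} [Fintype T] [DecidableEq T] [DecidableEq α]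
    (F : T → α) :
    (Fintype.card T) ^ 2
      ≤ (univ.image F).card * ((univ : Finset (T × T)).filter (fun p => F p.1 = F p.2)).card := by
  rw [card_pairs_eq_sum_sq, ← card_univ, card_eq_sum_card_image F univ]
  exact sq_sum_le_card_mul_sum_sq

end Summit.MatrixMultiplication.MatrixMultiplication.Theorems.TwistedTPP.FibreLines
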